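import Summits.KontsevichZagierPeriods.KontsevichZagierPeriods.Theses.UnfoldedStokes
import Literature.NumberTheory.Transcendental.KZKernelConjectureForms
import Literature.NumberTheory.Transcendental.KZCubicalCalculus
import Summits.KontsevichZagierPeriods.KontsevichZagierPeriods.Theorems.LogPrimitiveNL.Negative.Defs

/-!
# `CubeKernelStep` (stmt-KontsevichZagierPeriods-17854) — negative side I: calibration of the crux

cdisprove (refuter) calibration lemmas for the crux `CubeKernelStep` of route
`KontsevichZagierPeriods/UnfoldedStokes`:

  for every `d ≥ 1`: (continuous closed-cube kernel in dimensions `≤ d` lies in `KZ.relations`)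
  `→` (the same in dimension `d + 1`).

Everything is phrased RELATIVE TO AN ARBITRARY SUBGROUP `R ≤ FormalRep` (`KcIn R M` = layer `M` of the
continuous closed-cube kernel lands in `R`; `StepIn R` = the crux with `relations` replaced by `R`;
`CubeKernelStep ↔ StepIn relations` is `Iff.rfl`), so that sub-calculi can be used as models
(`Negative/FirstLayerRule2.lean`). Findings, all sorry-free:

* `kcIn_zero` — layer `0` holds in every `R` containing the integrand-additivity moves (a point
  representation of value `0` has integrand `0`);
* `stepIn_iff` — given layer `0`, the step is PURE LOGIC away from "layer 1 ⇒ all layers":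
  `StepIn R ↔ (KcIn R 1 → ∀ M, KcIn R M)`; hence `cubeKernelStep_iff`,
  `not_cubeKernelStep_iff : ¬ CubeKernelStep ↔ (KcIn relations 1 ∧ ∃ M, ¬ KcIn relations M)` —
  a refutation must PROVE the (open, Huber–Wüstholz-strength) interval layer AND refute a higher
  layer, i.e. the kernel conjecture (`not_kernelConjecture_of_not_cubeKernelStep`,
  `not_summit_of_not_cubeKernelStep`);
* `stepIn_of_not_kcIn_one` — the VACUITY MECHANISM: every subgroup in which layer `1` fails
  satisfies the step; so no sub-calculus / invariant model can refute the crux unless it certifies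
  the whole interval layer;
* `stepFromZeroIn_iff` — the crux WITHOUT its side condition `1 ≤ d` is "all layers"
  (`∀ M, KcIn R M`); in the full calculus this is summit-implied and open, in the rule-(2)-free
  calculus it is FALSE (`Negative/FirstLayerRule2.lean`): the side condition is load-bearing;
* `stepWithoutValue_false_of_kcIn_one` — the hypothesis `t.value = 0` of the conclusion is
  load-bearing modulo layer `1` (`[[0,1]², 1]` has value `1`; soundness).

[Kontsevich–Zagier 2001, §1.2; Ayoub 2015, Rem. 1.2]
-/

noncomputable section

namespace Summit.KontsevichZagierPeriods.UnfoldedStokes.CubeKernelStepNegative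

open MeasureTheory Set
open Literature.NumberTheory.Transcendental
open Literature.NumberTheory.Transcendental.KZ
open Summit.KontsevichZagierPeriods.KontsevichZagierPeriods.Theses.UnfoldedStokes (CubeKernelStep)

/-! ### The layers and the step, relative to a subgroup -/

/-- **Layer `M` of the continuous closed-cube kernel, relative to `R`**: every representation on the
closed unit cube `[0,1]^M` whose integrand is continuous on the closed cube and whose value is `0`
lies in `R` (verbatim the hypothesis / conclusion shape of the route decl `CubeKernelStep`, with
`relations` replaced by `R`). [cite: KontsevichZagier2001, §1.2] -/
def KcIn (R : AddSubgroup FormalRep) (M : ℕ) : Prop :=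
  ∀ t : IntegralRep M, t.domain = Set.pi Set.univ (fun _ : Fin M => Set.Icc (0:ℝ) 1) →
    ContinuousOn t.integrand t.domain → t.value = 0 → of t ∈ R

/-- **The step relative to `R`**: for `d ≥ 1`, layers `≤ d` in `R` imply layer `d + 1` in `R`.
[cite: Ayoub2015, Rem. 1.2] -/
def StepIn (R : AddSubgroup FormalRep) : Prop :=
  ∀ d : ℕ, 1 ≤ d → (∀ M : ℕ, M ≤ d → KcIn R M) → KcIn R (d + 1)

/-- **The step WITHOUT the side condition `1 ≤ d`**, relative to `R`. [cite: Ayoub2015, Rem. 1.2] -/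
def StepFromZeroIn (R : AddSubgroup FormalRep) : Prop :=
  ∀ d : ℕ, (∀ M : ℕ, M ≤ d → KcIn R M) → KcIn R (d + 1)

/-- The crux is the step relative to `relations` (definitional). [cite: KontsevichZagier2001, §1.2] -/
theorem cubeKernelStep_iff_stepIn : CubeKernelStep ↔ StepIn relations := Iff.rfl

/-! ### Layer 0 -/

/-- In dimension `0` the closed unit cube is the whole one-point space. [folklore] -/
theorem pi_fin_zero_eq_univ : Set.pi Set.univ (fun _ : Fin 0 => Set.Icc (0:ℝ) 1) = univ :=
  eq_univ_of_forall fun _ => by simp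

/-- The value of a dimension-`0` cube representation is its integrand at the point (integration over
`ℝ⁰` is evaluation: tree `LogPrimitiveNL.Negative.setIntegral_univ_fin_zero`). [folklore] -/
theorem value_of_dim_zero (t : IntegralRep 0)
    (ht : t.domain = Set.pi Set.univ (fun _ : Fin 0 => Set.Icc (0:ℝ) 1)) :
    t.value = t.integrand (fun i => i.elim0) := by
  rw [IntegralRep.value, ht, pi_fin_zero_eq_univ]
  exact Summit.KontsevichZagierPeriods.LiouvilleUnfolding.LogPrimitiveNL.Negative.setIntegral_univ_fin_zero _

/-- **Layer `0` holds** in every subgroup containing the integrand-additivity moves: a point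
representation of value `0` has integrand `0` at the point, and `[r] − [r] − [r]` is then a move of
rule (1b). [cite: KontsevichZagier2001, §1.2 rule (1)] -/
theorem kcIn_zero {R : AddSubgroup FormalRep} (hR : integrandAddRel ⊆ R) : KcIn R 0 := by
  intro t ht _ hv
  have h0 : ∀ x ∈ t.domain, t.integrand x = 0 := fun x _ => by
    rw [Subsingleton.elim x (fun i => i.elim0), ← value_of_dim_zero t ht, hv]
  have hmem : of t - of t - of t ∈ integrandAddRel :=
    ⟨0, t, t, t, rfl, rfl, fun x hx => by simp [h0 x hx], rfl⟩
  have h1 : -of t ∈ R := by simpa using hR hmem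
  simpa using R.neg_mem h1

/-- Layer `0` holds in the full calculus. [cite: KontsevichZagier2001, §1.2 rule (1)] -/
theorem kcIn_relations_zero : KcIn relations 0 := kcIn_zero integrandAddRel_subset_relations

/-! ### The step is pure logic away from "layer 1 ⇒ all layers" -/

/-- All layers give the step (trivially). [folklore] -/
theorem stepIn_of_forall {R : AddSubgroup FormalRep} (h : ∀ M, KcIn R M) : StepIn R :=
  fun d _ _ => h (d + 1)

/-- **VACUITY MECHANISM.** If layer `1` fails in `R`, the step holds in `R` — vacuously, its
hypothesis being unsatisfiable at every `d ≥ 1`. Consequently a sub-calculus or invariant model can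
refute the crux only if it CERTIFIES the whole interval layer. [folklore] -/
theorem stepIn_of_not_kcIn_one {R : AddSubgroup FormalRep} (h : ¬ KcIn R 1) : StepIn R :=
  fun _ hd hyp => absurd (hyp 1 hd) h

/-- **Given layer `0`, the step is equivalent to "layer `1` ⇒ all layers"** (strong induction; the
induction dressing of the crux adds nothing beyond its first missing input). [cite: Ayoub2015, Rem. 1.2] -/
theorem stepIn_iff {R : AddSubgroup FormalRep} (h0 : KcIn R 0) :
    StepIn R ↔ (KcIn R 1 → ∀ M, KcIn R M) := by
  constructor
  · intro hS h1 M
    induction M using Nat.strong_induction_on with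
    | _ M ih =>
      match M, ih with
      | 0, _ => exact h0
      | 1, _ => exact h1
      | d + 2, ih => exact hS (d + 1) (Nat.le_add_left 1 d) (fun M hM => ih M (by omega))
  · intro H d hd hyp
    exact H (hyp 1 hd) (d + 1)

/-- **The step without `1 ≤ d` is "all layers"**, given layer `0`. [cite: Ayoub2015, Rem. 1.2] -/
theorem stepFromZeroIn_iff {R : AddSubgroup FormalRep} (h0 : KcIn R 0) :
    StepFromZeroIn R ↔ ∀ M, KcIn R M := by
  constructor
  · intro hS M
    induction M using Nat.strong_induction_on with
    | _ M ih =>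
      match M, ih with
      | 0, _ => exact h0
      | d + 1, ih => exact hS d (fun M hM => ih M (by omega))
  · intro H d _
    exact H (d + 1)

/-- The step without `1 ≤ d` implies the step. [folklore] -/
theorem stepIn_of_stepFromZeroIn {R : AddSubgroup FormalRep} (h : StepFromZeroIn R) : StepIn R :=
  fun d _ hyp => h d hyp

/-! ### Consequences for the crux -/

/-- **CALIBRATION.** `CubeKernelStep ↔ (layer 1 ⇒ all layers)` in the full calculus.
[cite: Ayoub2015, Rem. 1.2] -/
theorem cubeKernelStep_iff : CubeKernelStep ↔ (KcIn relations 1 → ∀ M, KcIn relations M) :=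
  stepIn_iff kcIn_relations_zero

/-- **What a refutation of the crux must do**: prove the (open) interval layer AND exhibit a failing
higher layer. [cite: Ayoub2015, Rem. 1.2] -/
theorem not_cubeKernelStep_iff :
    ¬ CubeKernelStep ↔ (KcIn relations 1 ∧ ∃ M, ¬ KcIn relations M) := by
  rw [cubeKernelStep_iff]
  push Not
  rfl

/-- The kernel conjecture gives every layer. [cite: KontsevichZagier2001, §1.2 Conjecture 1] -/
theorem kcIn_relations_of_kernelConjecture (h : KZKernelConjecture) (M : ℕ) : KcIn relations M :=
  fun t _ _ hv => h _ (by rw [eval_of, hv])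

/-- **A refutation of the crux refutes the kernel conjecture** `ker eval ≤ relations`.
[cite: KontsevichZagier2001, §1.2 Conjecture 1] -/
theorem not_kernelConjecture_of_not_cubeKernelStep (h : ¬ CubeKernelStep) : ¬ KZKernelConjecture :=
  fun hK => h (stepIn_of_forall (kcIn_relations_of_kernelConjecture hK))

/-- **… hence the summit** `KontsevichZagierPeriods` (Kontsevich–Zagier's Conjecture 1 over the fixed
calculus; tree: `kzKernelConjecture_iff_isRational`). The GPC-strength barriers
`kzConjecture_implies_*` therefore apply to any refutation of the crux.
[cite: KontsevichZagier2001, §1.2 Conjecture 1] -/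
theorem not_summit_of_not_cubeKernelStep (h : ¬ CubeKernelStep) : ¬ _root_.KontsevichZagierPeriods :=
  fun hS => not_kernelConjecture_of_not_cubeKernelStep h
    ((kzKernelConjecture_iff_isRational.trans KontsevichZagierPeriods_iff.symm).mpr hS)

/-- **… and proves the interval layer** (all `ℚ̄`-linear relations among continuous real 1-periods
on `[0,1]` are chains of moves — Huber–Wüstholz strength inside the calculus).
[cite: HuberWustholz2022, Thm. 13.3] -/
theorem kcIn_one_of_not_cubeKernelStep (h : ¬ CubeKernelStep) : KcIn relations 1 :=
  (not_cubeKernelStep_iff.mp h).1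

/-- In the full calculus the crux WITHOUT `1 ≤ d` is exactly "all layers" — summit-implied
(`kcIn_relations_of_kernelConjecture`) and containing the open interval layer; the side condition
`1 ≤ d` is precisely what makes the crux conditional. [cite: Ayoub2015, Rem. 1.2] -/
theorem stepFromZeroIn_relations_iff : StepFromZeroIn relations ↔ ∀ M, KcIn relations M :=
  stepFromZeroIn_iff kcIn_relations_zero

/-! ### `t.value = 0` is load-bearing modulo the interval layer -/

/-- The constant-one representation on the closed unit cube `[0,1]ⁿ` (value `1`).
[cite: KontsevichZagier2001, §1.1] -/
def unitCubeRep (n : ℕ) : IntegralRep n :=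
  IntegralRep.tameCube (fun _ => (1 : ℝ)) (fun _ _ => analyticAt_const)
    ((isSemialgebraicFunOn_natCast isSemialgebraic_cube 1).congr fun _ _ => by simp)

/-- `[[0,1]ⁿ, 1]` has value `1`. [folklore] -/
@[simp] theorem value_unitCubeRep (n : ℕ) : (unitCubeRep n).value = 1 := by
  simp [IntegralRep.value, unitCubeRep, IntegralRep.tameCube]

/-- The domain of `[[0,1]ⁿ, 1]` in the product form of the crux. [folklore] -/
theorem unitCubeRep_domain (n : ℕ) :
    (unitCubeRep n).domain = Set.pi Set.univ (fun _ : Fin n => Set.Icc (0:ℝ) 1) := cube_eq_pi n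

/-- The step WITHOUT the hypothesis `t.value = 0` in its conclusion, relative to `R`. -/
def StepWithoutValueIn (R : AddSubgroup FormalRep) : Prop :=
  ∀ d : ℕ, 1 ≤ d → (∀ M : ℕ, M ≤ d → KcIn R M) →
    ∀ t : IntegralRep (d + 1), t.domain = Set.pi Set.univ (fun _ : Fin (d + 1) => Set.Icc (0:ℝ) 1) →
      ContinuousOn t.integrand t.domain → of t ∈ R

/-- **`t.value = 0` is load-bearing modulo layer `1`** (the most that can be said unconditionally,
the hypothesis side of the implication being open): granted the interval layer, the value-free step
would put `[[0,1]², 1]` (value `1`) into `relations ≤ ker eval`. [cite: KontsevichZagier2001, §1.2] -/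
theorem stepWithoutValue_false_of_kcIn_one (h1 : KcIn relations 1) :
    ¬ StepWithoutValueIn relations := by
  intro h
  have hle : ∀ M : ℕ, M ≤ 1 → KcIn relations M := fun M hM => by
    interval_cases M
    · exact kcIn_relations_zero
    · exact h1
  have hmem := h 1 le_rfl hle (unitCubeRep 2) (unitCubeRep_domain 2)
    (by rw [unitCubeRep_domain]; exact continuousOn_const)
  have h0 := relations_le_ker_eval_holds hmem
  rw [AddMonoidHom.mem_ker, eval_of, value_unitCubeRep] at h0
  exact one_ne_zero h0

end Summit.KontsevichZagierPeriods.UnfoldedStokes.CubeKernelStepNegative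

end
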